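import Literature.Topology.FourManifolds.TrisectionsStabilization
import HarnessLib

/-!
# Gay–Kirby's stabilisation inside a prescribed open set

Topic `Literature/Topology/FourManifolds`; infrastructure for the fact seat
`provefact-Literature.Topology.FourManifolds.exists-14560f9fc8` (named fact (c′)
`Literature.Topology.FourManifolds.exists_stabilized_gkTrisection`, Gay–Kirby 2016, Def. 8 and
Lemma 10).  Everything in this file is **proved**; no definitions, no named facts.

Refinement of `IsGKTrisection.exists_stabilization` (`TrisectionsStabilization.lean`) needed
for the `π₁` computation of Abrams–Gay–Kirby's Thm. 5 (which is phrased for a stabilisation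
performed inside one small ball): the three implants can be performed inside any prescribed
open set `Ω₀` meeting the central surface, the trisection being unchanged off `Ω₀`
(`IsGKTrisection.exists_stabilization_in`).  The only new ingredient is that the central surface
has points different from, but arbitrarily close to, any of its points
(`SectorNormalForm.exists_ne_mem_of_mem_nhds`, from a corner-slice chart).

## References

* D. Gay, R. Kirby, *Trisecting 4-manifolds*, Geom. Topol. 20 (2016), Def. 8 and Lemma 10.
  [GayKirby2016]
-/

open scoped Manifold ContDiff Topology
open Set Function Filter

noncomputable section

namespace Literature.Topology.FourManifolds

universe u

section Local

variable {X : Type u} [TopologicalSpace X] [T2Space X] [CompactSpace X]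
  [ChartedSpace (EuclideanSpace ℝ (Fin 4)) X] [IsManifold (𝓡 4) ∞ X]

omit [T2Space X] [CompactSpace X] [IsManifold (𝓡 4) ∞ X] in
/-- **The central surface accumulates at each of its points**: for `x ∈ F` and a neighbourhood
`Ω` of `x` there is `x' ∈ F ∩ Ω` with `x' ≠ x` (move along the corner stratum in a corner-slice
chart). [cite: GayKirby2016, Def. 1] -/
theorem SectorNormalForm.exists_ne_mem_of_mem_nhds {Sm F : Set X} {u v : X → ℝ} {ρ : X → X}
    {U O : Set X} {cm : ℕ → ℕ} (hS : SectorNormalForm Sm F u v ρ U O cm) {x : X} (hx : x ∈ F)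
    {Ω : Set X} (hΩ : Ω ∈ 𝓝 x) : ∃ x' ∈ F, x' ≠ x ∧ x' ∈ Ω := by
  obtain ⟨C, hxC, -⟩ := hS.corner x hx
  set z : EuclideanSpace ℝ (Fin 4) := C.Θ x with hz
  have hzT : z ∈ C.Θ.target := C.Θ.map_source hxC
  obtain ⟨hu0, hv0⟩ := (C.mem_K_iff x hxC).1 hx
  -- the curve `s ↦ Θ⁻¹ (z + s e₂)` in `F`
  have hcurve : Tendsto (fun s : ℝ => z + s • EuclideanSpace.single (2 : Fin 4) (1:ℝ)) (𝓝 0) (𝓝 z) := by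
    have : Continuous fun s : ℝ => z + s • EuclideanSpace.single (2 : Fin 4) (1:ℝ) := by fun_prop
    simpa using this.tendsto 0
  have hγ : Tendsto (fun s : ℝ => C.Θ.symm (z + s • EuclideanSpace.single (2 : Fin 4) (1:ℝ))) (𝓝 0) (𝓝 x) := by
    have h2 : ContinuousAt C.Θ.symm z := C.Θ.continuousAt_symm hzT
    have h3 := h2.tendsto.comp hcurve
    rw [hz, C.Θ.left_inv hxC] at h3
    exact h3
  have hT : ∀ᶠ s in 𝓝 (0:ℝ), z + s • EuclideanSpace.single (2 : Fin 4) (1:ℝ) ∈ C.Θ.target :=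
    hcurve.eventually (C.Θ.open_target.mem_nhds hzT)
  have hΩ' : ∀ᶠ s in 𝓝 (0:ℝ), C.Θ.symm (z + s • EuclideanSpace.single (2 : Fin 4) (1:ℝ)) ∈ Ω := hγ.eventually hΩ
  have hne : ∀ᶠ s in 𝓝[≠] (0:ℝ), s ≠ 0 := self_mem_nhdsWithin
  obtain ⟨s, hsT, hsΩ, hs0⟩ := ((hT.filter_mono nhdsWithin_le_nhds).and
    ((hΩ'.filter_mono nhdsWithin_le_nhds).and hne)).exists
  set z' : EuclideanSpace ℝ (Fin 4) := z + s • EuclideanSpace.single (2 : Fin 4) (1:ℝ) with hz'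
  have hsrc : C.Θ.symm z' ∈ C.Θ.source := C.Θ.map_target hsT
  refine ⟨C.Θ.symm z', ?_, fun h => hs0 ?_, hsΩ⟩
  · rw [C.mem_K_iff _ hsrc, ← C.apply_zero _ hsrc, ← C.apply_one _ hsrc, C.Θ.right_inv hsT]
    refine ⟨?_, ?_⟩
    · show z 0 + (s • EuclideanSpace.single (2 : Fin 4) (1:ℝ)) 0 = 0
      rw [hz, C.apply_zero x hxC, hu0]; simp
    · show z 1 + (s • EuclideanSpace.single (2 : Fin 4) (1:ℝ)) 1 = 0
      rw [hz, C.apply_one x hxC, hv0]; simp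
  · have h1 := congrArg C.Θ h
    rw [C.Θ.right_inv hsT, ← hz] at h1
    have h2 := congrArg (fun w : EuclideanSpace ℝ (Fin 4) => w 2) h1
    simp [hz'] at h2
    exact h2

/-- **Three implants with faces inside a prescribed open set `Ω₀`**: the stabilised trisection
agrees with the old one off `Ω₀`, and its central surface still meets `Ω₀`.
[cite: GayKirby2016, Def. 8 and Lemma 10] -/
theorem TriNormalForm.exists_stabilizationF_in {S : Fin 3 → Set X} {i j l : Fin 3} {u v : X → ℝ}
    {ρ : X → X} {U O : Set X} {c : Fin 3 → ℕ → ℕ} {f₁ f₂ f₃ : ℕ → ℕ}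
    (hT : TriNormalForm S i j l u v ρ U O c)
    (hQ₁ : FaceNormalForm (S i ∩ S j) (⋂ m, S m) u v U f₁)
    (hQ₂ : FaceNormalForm (S j ∩ S l) (⋂ m, S m) (fun y => v y - u y) (fun y => -u y) U f₂)
    (hQ₃ : FaceNormalForm (S l ∩ S i) (⋂ m, S m) (fun y => -v y) (fun y => u y - v y) U f₃)
    {Ω₀ : Set X} (hΩ₀ : IsOpen Ω₀) (hne : ((⋂ m, S m) ∩ Ω₀).Nonempty) :
    ∃ (S' : Fin 3 → Set X) (u' v' : X → ℝ) (ρ' : X → X) (O' : Set X),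
      TriNormalForm S' i j l u' v' ρ' U O' (fun m n => c m n + if n = 1 then 1 else 0) ∧
      FaceNormalForm (S' i ∩ S' j) (⋂ m, S' m) u' v' U (fun n => f₁ n + if n = 1 then 3 else 0) ∧
      FaceNormalForm (S' j ∩ S' l) (⋂ m, S' m) (fun y => v' y - u' y) (fun y => -u' y) U
        (fun n => f₂ n + if n = 1 then 3 else 0) ∧
      FaceNormalForm (S' l ∩ S' i) (⋂ m, S' m) (fun y => -v' y) (fun y => u' y - v' y) U
        (fun n => f₃ n + if n = 1 then 3 else 0) ∧
      (∀ m, ∀ y ∉ Ω₀, y ∈ S' m ↔ y ∈ S m) ∧ ((⋂ m, S' m) ∩ Ω₀).Nonempty := by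
  -- rotation of the bundled configuration
  have rotate : ∀ {S₀ : Fin 3 → Set X} {i₀ j₀ l₀ : Fin 3} {u₀ v₀ : X → ℝ} {ρ₀ : X → X} {O₀ : Set X}
      {c₀ : Fin 3 → ℕ → ℕ} {g₁ g₂ g₃ : ℕ → ℕ},
      TriNormalForm S₀ i₀ j₀ l₀ u₀ v₀ ρ₀ U O₀ c₀ →
      FaceNormalForm (S₀ i₀ ∩ S₀ j₀) (⋂ m, S₀ m) u₀ v₀ U g₁ →
      FaceNormalForm (S₀ j₀ ∩ S₀ l₀) (⋂ m, S₀ m) (fun y => v₀ y - u₀ y) (fun y => -u₀ y) U g₂ →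
      FaceNormalForm (S₀ l₀ ∩ S₀ i₀) (⋂ m, S₀ m) (fun y => -v₀ y) (fun y => u₀ y - v₀ y) U g₃ →
      TriNormalForm S₀ j₀ l₀ i₀ (fun y => v₀ y - u₀ y) (fun y => -u₀ y) ρ₀ U O₀ c₀ ∧
      FaceNormalForm (S₀ j₀ ∩ S₀ l₀) (⋂ m, S₀ m) (fun y => v₀ y - u₀ y) (fun y => -u₀ y) U g₂ ∧
      FaceNormalForm (S₀ l₀ ∩ S₀ i₀) (⋂ m, S₀ m)
        (fun y => (fun y => -u₀ y) y - (fun y => v₀ y - u₀ y) y) (fun y => -(fun y => v₀ y - u₀ y) y) U g₃ ∧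
      FaceNormalForm (S₀ i₀ ∩ S₀ j₀) (⋂ m, S₀ m)
        (fun y => -(fun y => -u₀ y) y) (fun y => (fun y => v₀ y - u₀ y) y - (fun y => -u₀ y) y) U g₁ := by
    intro S₀ i₀ j₀ l₀ u₀ v₀ ρ₀ O₀ c₀ g₁ g₂ g₃ hT₀ h₁ h₂ h₃
    refine ⟨hT₀.rotate, h₂, ?_, ?_⟩
    · have e1 : (fun y => (fun y => -u₀ y) y - (fun y => v₀ y - u₀ y) y) = fun y => -v₀ y := funext fun y => by ring
      have e2 : (fun y => -(fun y => v₀ y - u₀ y) y) = fun y => u₀ y - v₀ y := funext fun y => by ring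
      rw [e1, e2]; exact h₃
    · have e3 : (fun y => -(fun y => -u₀ y) y) = u₀ := funext fun y => by ring
      have e4 : (fun y => (fun y => v₀ y - u₀ y) y - (fun y => -u₀ y) y) = v₀ := funext fun y => by ring
      rw [e3, e4]; exact h₁
  -- one implant inside `Ω₀` preserving a point of the central surface in `Ω₀`
  have step : ∀ {S₀ : Fin 3 → Set X} {i₀ j₀ l₀ : Fin 3} {u₀ v₀ : X → ℝ} {ρ₀ : X → X} {O₀ : Set X}
      {c₀ : Fin 3 → ℕ → ℕ} {g₁ g₂ g₃ : ℕ → ℕ},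
      TriNormalForm S₀ i₀ j₀ l₀ u₀ v₀ ρ₀ U O₀ c₀ →
      FaceNormalForm (S₀ i₀ ∩ S₀ j₀) (⋂ m, S₀ m) u₀ v₀ U g₁ →
      FaceNormalForm (S₀ j₀ ∩ S₀ l₀) (⋂ m, S₀ m) (fun y => v₀ y - u₀ y) (fun y => -u₀ y) U g₂ →
      FaceNormalForm (S₀ l₀ ∩ S₀ i₀) (⋂ m, S₀ m) (fun y => -v₀ y) (fun y => u₀ y - v₀ y) U g₃ →
      ((⋂ m, S₀ m) ∩ Ω₀).Nonempty →
      ∃ (S₁ : Fin 3 → Set X) (u₁ v₁ : X → ℝ) (ρ₁ : X → X) (O₁ : Set X),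
        TriNormalForm S₁ i₀ j₀ l₀ u₁ v₁ ρ₁ U O₁
          (Function.update c₀ i₀ (fun n => c₀ i₀ n + if n = 1 then 1 else 0)) ∧
        FaceNormalForm (S₁ i₀ ∩ S₁ j₀) (⋂ m, S₁ m) u₁ v₁ U (fun n => g₁ n + if n = 1 then 1 else 0) ∧
        FaceNormalForm (S₁ j₀ ∩ S₁ l₀) (⋂ m, S₁ m) (fun y => v₁ y - u₁ y) (fun y => -u₁ y) U
          (fun n => g₂ n + if n = 1 then 1 else 0) ∧
        FaceNormalForm (S₁ l₀ ∩ S₁ i₀) (⋂ m, S₁ m) (fun y => -v₁ y) (fun y => u₁ y - v₁ y) U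
          (fun n => g₃ n + if n = 1 then 1 else 0) ∧
        (∀ m, ∀ y ∉ Ω₀, y ∈ S₁ m ↔ y ∈ S₀ m) ∧ ((⋂ m, S₁ m) ∩ Ω₀).Nonempty := by
    intro S₀ i₀ j₀ l₀ u₀ v₀ ρ₀ O₀ c₀ g₁ g₂ g₃ hT₀ h₁ h₂ h₃ hne₀
    obtain ⟨x, hx, hxΩ₀⟩ := hne₀
    obtain ⟨x₁, hx₁, hx₁x, hx₁Ω₀⟩ := hT₀.sector_i.exists_ne_mem_of_mem_nhds hx (hΩ₀.mem_nhds hxΩ₀)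
    have hΩo : IsOpen (Ω₀ ∩ {x₁}ᶜ) := hΩ₀.inter (isClosed_singleton (x := x₁)).isOpen_compl
    obtain ⟨S₁, u₁, v₁, ρ₁, O₁, hT₁, hSagree, -, hF₁, hF₂, hF₃⟩ :=
      hT₀.exists_implantF h₁ h₂ h₃ hx hΩo ⟨hxΩ₀, fun h => hx₁x h.symm⟩
    refine ⟨S₁, u₁, v₁, ρ₁, O₁, hT₁, hF₁, hF₂, hF₃, fun m y hy => hSagree m y (fun h => hy h.1),
      ⟨x₁, mem_iInter.2 fun m => ?_, hx₁Ω₀⟩⟩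
    exact (hSagree m x₁ (fun h => h.2 rfl)).2 (mem_iInter.1 hx₁ m)
  -- three implants
  obtain ⟨S₁, u₁, v₁, ρ₁, O₁, hT₁, hA₁, hB₁, hC₁, hag₁, hne₁⟩ := step hT hQ₁ hQ₂ hQ₃ hne
  obtain ⟨hT₁', hA₁', hB₁', hC₁'⟩ := rotate hT₁ hA₁ hB₁ hC₁
  obtain ⟨S₂, u₂, v₂, ρ₂, O₂, hT₂, hA₂, hB₂, hC₂, hag₂, hne₂⟩ := step hT₁' hA₁' hB₁' hC₁' hne₁
  obtain ⟨hT₂', hA₂', hB₂', hC₂'⟩ := rotate hT₂ hA₂ hB₂ hC₂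
  obtain ⟨S₃, u₃, v₃, ρ₃, O₃, hT₃, hA₃, hB₃, hC₃, hag₃, hne₃⟩ := step hT₂' hA₂' hB₂' hC₂' hne₂
  obtain ⟨hT₄, hA₄, hB₄, hC₄⟩ := rotate hT₃ hA₃ hB₃ hC₃
  refine ⟨S₃, fun y => v₃ y - u₃ y, fun y => -u₃ y, ρ₃, O₃, ?_, ?_, ?_, ?_,
    fun m y hy => ((hag₃ m y hy).trans (hag₂ m y hy)).trans (hag₁ m y hy), hne₃⟩
  · have hij := hT.ne_ij
    have hjl := hT.ne_jl
    have hil := hT.ne_il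
    have hc : Function.update (Function.update (Function.update c i fun n => c i n + if n = 1 then 1 else 0) j
          fun n => Function.update c i (fun n => c i n + if n = 1 then 1 else 0) j n + if n = 1 then 1 else 0) l
        (fun n => Function.update (Function.update c i fun n => c i n + if n = 1 then 1 else 0) j
          (fun n => Function.update c i (fun n => c i n + if n = 1 then 1 else 0) j n + if n = 1 then 1 else 0) l n +
          if n = 1 then 1 else 0) = fun m n => c m n + if n = 1 then 1 else 0 := by
      funext m n
      rcases hT.eq_or m with rfl | rfl | rfl
      · rw [Function.update_of_ne hil, Function.update_of_ne hij, Function.update_self]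
      · rw [Function.update_of_ne hjl, Function.update_self, Function.update_of_ne (Ne.symm hij)]
      · rw [Function.update_self, Function.update_of_ne (Ne.symm hjl), Function.update_of_ne (Ne.symm hil)]
    rw [hc] at hT₄
    exact hT₄
  · have : (fun n => (f₁ n + if n = 1 then 1 else 0) + (if n = 1 then 1 else 0) + if n = 1 then 1 else 0) =
        fun n => f₁ n + if n = 1 then 3 else 0 := by
      funext n; split_ifs <;> omega
    rw [← this]; exact hA₄
  · have : (fun n => (f₂ n + if n = 1 then 1 else 0) + (if n = 1 then 1 else 0) + if n = 1 then 1 else 0) =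
        fun n => f₂ n + if n = 1 then 3 else 0 := by
      funext n; split_ifs <;> omega
    rw [← this]; exact hB₄
  · have : (fun n => (f₃ n + if n = 1 then 1 else 0) + (if n = 1 then 1 else 0) + if n = 1 then 1 else 0) =
        fun n => f₃ n + if n = 1 then 3 else 0 := by
      funext n; split_ifs <;> omega
    rw [← this]; exact hC₄

/-- **Gay–Kirby's Lemma 10 inside a prescribed open set**: a `(g; k₁, k₂, k₃)`-trisection with
corners whose central surface meets the open set `Ω₀` can be stabilised to a
`(g + 3; k₁ + 1, k₂ + 1, k₃ + 1)`-trisection which agrees with it off `Ω₀`.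
[cite: GayKirby2016, Def. 8 and Lemma 10] -/
theorem IsGKTrisection.exists_stabilization_in {g : ℕ} {k : Fin 3 → ℕ} {S : Fin 3 → Set X}
    (h : IsGKTrisection X g k S) {Ω₀ : Set X} (hΩ₀ : IsOpen Ω₀) (hne : ((⋂ m, S m) ∩ Ω₀).Nonempty) :
    ∃ S' : Fin 3 → Set X, IsGKTrisection X (g + 3) (fun m => k m + 1) S' ∧
      (∀ m, ∀ y ∉ Ω₀, y ∈ S' m ↔ y ∈ S m) ∧ ((⋂ m, S' m) ∩ Ω₀).Nonempty := by
  obtain ⟨u, v, U, O, ρ, hT⟩ := h.exists_triNormalForm (i := 0) (j := 1) (l := 2) (by decide) (by decide) (by decide)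
  obtain ⟨hQ₁, hQ₂, hQ₃⟩ := h.faceNormalForms hT
  obtain ⟨S', u', v', ρ', O', hT', hF₁, hF₂, hF₃, hagree, hne'⟩ :=
    hT.exists_stabilizationF_in hQ₁ hQ₂ hQ₃ hΩ₀ hne
  have hcnt : (fun m n => handleCount 1 (k m) n + if n = 1 then 1 else 0) = fun m => handleCount 1 (k m + 1) := by
    funext m; exact handleCount_add_indicator_one (k m)
  rw [hcnt] at hT'
  have hg : ∀ f : ℕ → ℕ, f = handleCount 1 g → (fun n => f n + if n = 1 then 3 else 0) = handleCount 1 (g + 3) := by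
    rintro f rfl
    funext n
    unfold handleCount
    rcases n with _ | _ | n <;> simp
  rw [hg _ rfl] at hF₁ hF₂ hF₃
  refine ⟨S', isGKTrisection_of_triNormalForm hT' fun a b hab => ?_, hagree, hne'⟩
  have key : ∀ {a b : Fin 3} {nrm col : X → ℝ}, FaceNormalForm (S' a ∩ S' b) (⋂ m, S' m) nrm col U (handleCount 1 (g + 3)) →
      ∀ a' b', S' a' ∩ S' b' = S' a ∩ S' b →
      ∃ (H : Type u) (_ : TopologicalSpace H) (_ : ChartedSpace (EuclideanHalfSpace 3) H) (h : H → X),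
        IsManifold (𝓡∂ 3) ∞ H ∧ CompactSpace H ∧ ConnectedSpace H ∧
          HasHandleDecomposition 2 H (handleCount 1 (g + 3)) ∧
          Manifold.IsSmoothEmbedding (𝓡∂ 3) (𝓡 4) ∞ h ∧ range h = S' a' ∩ S' b' ∧
          h '' (𝓡∂ 3).boundary H = ⋂ m, S' m := by
    intro a b nrm col hQ a' b' heq
    obtain ⟨H, _, _, hmap, hM, hc, hconn, hHD, hemb, hrange, hbd⟩ := hQ.face_clause
    exact ⟨H, _, _, hmap, hM, hc, hconn, hHD, hemb, by rw [heq]; exact hrange, hbd⟩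
  fin_cases a <;> fin_cases b
  · exact absurd rfl hab
  · exact key hF₁ _ _ rfl
  · exact key hF₃ _ _ (inter_comm _ _)
  · exact key hF₁ _ _ (inter_comm _ _)
  · exact absurd rfl hab
  · exact key hF₂ _ _ rfl
  · exact key hF₃ _ _ rfl
  · exact key hF₂ _ _ (inter_comm _ _)
  · exact absurd rfl hab

end Local

end Literature.Topology.FourManifolds
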